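import Summits.AtomisticToContinuum.FouriersLaw.Theorems.HonestZwanzigRobinCoercivityLimitOperatorTransfer
import Summits.AtomisticToContinuum.FouriersLaw.Theorems.HonestZwanzigRobinCoercivitySymbolNonneg
import Summits.AtomisticToContinuum.FouriersLaw.Theorems.HonestZwanzigRobinCoercivityBlockInputsCorollaries
import Summits.AtomisticToContinuum.FouriersLaw.Theorems.HonestZwanzigRobinCoercivityPositiveMemoryOfBlockInputs
import Summits.AtomisticToContinuum.FouriersLaw.Theorems.RobinCoercivity.Negative.WithoutCoupling
import Summits.AtomisticToContinuum.FouriersLaw.Theorems.RobinCoercivity.Negative.ContactCeiling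

/-!
# `HonestZwanzig.RobinCoercivity` — line `limit-operator-memory-form` (crux skeleton, rev 5 — engine, transfer and links LANDED)

Crux `stmt-AtomisticToContinuum-12695`, decl `Summit.AtomisticToContinuum.FouriersLaw.Theses.HonestZwanzig.RobinCoercivity`
(route `route-AtomisticToContinuum-HonestZwanzig`, sub-problem `FouriersLaw`). Idea card
`Cruxes/RobinCoercivity/Ideas/limit-operator-memory-form.md` (round 2, passed triage r2-1/r2-2); line card
`Cruxes/RobinCoercivity/Lines/limit-operator-memory-form.md`.

THE LINE. By the landed even/odd decomposition (`…Negative.feshbach_quadratic_decomposition`, p105753) the Feshbach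
quadratic form is `ξᵀ𝔽_N(s)ξ = s·ξᵀCov(e,e)ξ + (Bξ)ᵀ W_N(s) (Bξ)` with `Bξ = (ξ_0; (ξ_i − ξ_{i−1})_{1≤i≤N−1}; ξ_{N−1}) ∈ ℝ^{N+1}`
(bond ⊕ contact coordinates on the POSITIONS `0 … N`: position `0` = left contact, `1 … N−1` = bonds, `N` = right contact;
`|Bξ|²` IS the crux's Robin form) and the `(N+1)×(N+1)` BLOCK MEMORY MATRIX
`W_N(s)_{ij} = γT²·[i = j contact] − schur_s(g_i∘Θ, g_j)`, `g_i` = the bond current `j_{i−1}` at a bond position, the bath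
observable `γ(T − p_c²)` at a contact (`stub_blockForm`). So the crux is N-uniform coercivity of the symmetric matrices
`W_N(0⁺)` on `Ran B`. The lever is the LIMIT-OPERATOR PRINCIPLE for such a family: a discrete IMS localisation
(`stub_imsLocalisation`: window coercivity `c` + off-band commutator `E` ⇒ global coercivity `c − 5E`, sine/cosine partition
of unity with one merged window at each corner) reduces `inf_N λ_min(W_N)` to (i) the bottom of the bulk Toeplitz symbol
(`stub_toeplitzSymbol`: Parseval + compactness of the circle turn POINTWISE positivity of a summable symbol into a uniform
section bound) and (ii) the bottoms of the two corner compressions. Inputs about the chain: (U′) uniform ℓ¹ off-band tails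
of `W_N(0⁺)` (`stub_bandDomination`), (L) entrywise bulk limit `𝔎_N(0⁺)_{bb'} → K_∞(b−b')` (`stub_bulkLimit`) — both the
matrix form of the route's rank-2 crux `OrthogonalOhm` (its foreseen UniformLocality/BulkLimit split), i.e. DECAY /
convergence statements for the orthogonal-dynamics CURRENT memory, not coercivity and not Γ-boundedness — and the two
qualitative residues that are this crux's own: (Q1) the limit symbol `K̂_∞(θ) = Σ_z K_∞(z)cos(zθ)` is `> 0` at every `θ`
(`stub_symbolPositivity`; `K̂_∞ ≥ 0` is automatic from `schur_self_nonneg`, `K̂_∞(0) = k` is `PositiveMemory`'s end), and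
(Q2) the corner compressions of `W_N(0⁺)` of every fixed size are coercive for `N` large — no contact-trapped zero mode
(`stub_cornerCoercivity`; this is where `γ > 0` is load-bearing: at `γ = 0` the contact coordinate is an exact zero mode of
every corner section, `…Negative.robinCoercivity_false_without_coupling`). Small `N < N₁` is covered by the landed
`Robin.robinCoercivity_pointwise` (p105615), which thereby becomes load-bearing.

COMPOSITION (sorry-free, this file): `RobinCoercivity_of : RobinCoercivity` — constants `m₁` (symbol bottom, Toeplitz),
`m₂` (corner bottom), `c_w = min(m₁/2, m₂)`; choose `D` with `τ(D) ≤ c_w/20`, `L` with `D²τ(0)/L² ≤ c_w/20` (so `5E ≤ c_w/2`),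
`ε = m₁/(4L)` ↦ `R`, corner window `R + 1 + 2L` ↦ `N₁`; for `N ≥ N₁`: `W_N(s) ⪰ c_w/2` on all of `ℝ^{N+1}` for
`s < min(s₁,s₂,s₃)`, hence `ξᵀ𝔽ξ ≥ (c_w/2)|Bξ|²`; for `2 ≤ N < N₁` the pointwise constants; `c` = their finite minimum.

Honest non-example (recorded on the card): at the HARMONIC point `W_N(0)` is dense (ballistic tent, row sums `∝ N²`) — U′/L
fail while the crux holds; the line is a DIFFUSIVE (sufficient) mechanism, exactly the route's rank-2 bet. In the one
rigorously diffusive member (velocity-flip chain, triage kit j021676/j021689) every stub holds and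
`c_N = min(min_θ K̂_∞, corner bottom)` to four digits.

STATE (rev 4, lead c2, 2026-08-17). LANDED in `Theorems/`: the three engine stubs — `Robin.stub_imsLocalisation` (p152589, aux
p152332), `Robin.stub_toeplitzSymbol` (p151907), `Robin.stub_blockForm` (p152975, aux p152804) —, the IMS engine
`Robin.coercive_of_pieces` (…TransferA, p152828), and the TRANSFER THEOREM with the four inputs as named Props
(…LimitOperatorTransfer, p153458): `Robin.robinCoercivity_of_limitOperatorInputs : BlockBandDomination → BlockBulkLimit →
BulkSymbolPositivity → CornerCoercivity → RobinCoercivity`; also the lower half of (Q1), `Robin.symbol_nonneg_of_bulkLimit`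
(p152997). So this skeleton is now: the four OPEN stubs (verbatim `Robin.BlockBandDomination` (U′), `Robin.BlockBulkLimit` (L,
rev 2: convergence at fixed distance), `Robin.BulkSymbolPositivity` (Q1), `Robin.CornerCoercivity` (Q2)) and a one-line
composition. All four are open-problem class (audits by workers w-bulklimit / w-symbol / w-corner: no misstatement; U′, L =
rank-2 `OrthogonalOhm` UniformLocality/BulkLimit in matrix form; Q1 at θ = 0 = rank-3 `PositiveMemory`; Q2 already at window
w = 1 = the crux's own N-uniform contact-conductance floor). Hardest / held by the lead: `stub_bandDomination` (numerics of the
rows of W_N(s) for the anharmonic chain: kit jobs j024572/607/608/609/639/792, numerics/wrows in the lead's folder).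

STRUCTURE LANDED AROUND THE FOUR OPEN STUBS (rev 5; all in `Theorems/HonestZwanzigRobinCoercivity*.lean`, namespace `…Robin`). With
S := {`BlockBandDomination` (U′), `BlockBulkLimit` (L), `BlockDiagBound`} (rank-2 locality/boundedness class, to be filed ONCE as
support items shared with `OrthogonalOhm`) and R := {`BulkSymbolPositivity` (Q1), `CornerCoercivity` (Q2)} (this crux's residues):
`allCruxes_of_blockInputs : S → R → OrthogonalOhm ∧ PositiveMemory ∧ RobinCoercivity` (p170435/p169571: `orthogonalOhm_of_blockInputs`
p169484, `positiveMemory_of_blockInputs` p169723, transfer p153458); `robinCoercivity_iff_residues' : S → (RobinCoercivity ↔ Q1 ∧ Q2)`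
(p168655/p156584, from the necessity `symbol_ge_of_robinCoercivity` p155434 and `cornerCoercivity_of_robinCoercivity` p156434);
`symbolZero_pos_of_positiveMemory` (p154765: Q1 at θ = 0 ⇐ PositiveMemory + U′); `symbol_nonneg_of_bulkLimit` (p152997: Q1's lower
half unconditional); `bulkRowSum_of_blockInputs` (p168523). So the route's ENTIRE remaining open content is S ∪ R.
-/

noncomputable section

open MeasureTheory Finset Matrix Filter Topology
open Literature.MathematicalPhysics.KineticTheory.HeatConduction
open Summit.AtomisticToContinuum.FouriersLaw.Theses.HonestZwanzig
open Summit.AtomisticToContinuum.FouriersLaw.Theorems.HonestZwanzig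
open Summit.AtomisticToContinuum.FouriersLaw.Theorems.RobinCoercivity

namespace Summit.AtomisticToContinuum.FouriersLaw.Cruxes.RobinCoercivity.LimitOperatorMemoryForm

/-! ## Registered stubs -/

/-! ### Open stubs — the N-uniform inputs (U′), (L): rank-2 class, shared with `OrthogonalOhm` -/

/-- STUB (registered, OPEN — HARDEST; rank-2 class = `OrthogonalOhm`'s foreseen UniformLocality) — UNIFORM BAND-DOMINATION of
the block memory matrix: for `pinnedChain ω₂ lam β γ` (all `> 0`) and `T > 0` there is a tail profile `τ : ℕ → ℝ` with
`τ(d) → 0` such that for every `N ≥ 2` and all small `s > 0`, every row of `W_N(s)` has off-band ℓ¹ tail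
`Σ_{j : |i−j| > d} |W_N(s)_{ij}| ≤ τ(d)` (all `d`; `d = 0` is the uniform off-diagonal row bound). Informal content: the
zero-frequency memory of the ORTHOGONAL dynamics between bond currents (and between a contact observable and the bond
currents) decays in the distance, summably and uniformly in `N` — locality of the projected current memory on the
mean-free-path scale `ℓ(T)`; second moments are NOT asked (triage sharpening: nonlinear fluctuating hydrodynamics predicts
`K_∞(z) ≍ z⁻²`, summable without second moment). Why plausible: exact in the velocity-flip chain (rows `0.072, 0.0094,
0.0019, 1e-4`, N-identical 16…64, kit j021689); the item's MD shows the dual object local (`|Γ_{c,c+d}| ≤ 0.1`, `d ≥ 2`).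
Why it might fail: a flat (rank-one, total-flux) tail of the cross row as at the HARMONIC point (`0.030`, j021400), or
algebraic tails too fat to be ℓ¹. FALSE at `lam = β = 0` (ballistic tent) although the crux holds there: sufficient, not
necessary. Barrier `FixedLengthNoConductivityControl` bites honestly (decay of correlations for the deterministic bulk). -/
theorem stub_bandDomination : ∀ ω₂ lam β γ : ℝ, 0 < ω₂ → 0 < lam → 0 < β → 0 < γ → ∀ T : ℝ, 0 < T →
    ∃ τ : ℕ → ℝ, Tendsto τ atTop (𝓝 0) ∧ ∀ N : ℕ, 2 ≤ N → ∃ s₀ : ℝ, 0 < s₀ ∧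
    ∀ (lap : ℝ → (PhaseSpace N → ℝ) → (PhaseSpace N → ℝ) → ℝ) (e : Fin N → PhaseSpace N → ℝ)
      (G : ℝ → Matrix (Fin N) (Fin N) ℝ) (schur : ℝ → (PhaseSpace N → ℝ) → (PhaseSpace N → ℝ) → ℝ)
      (g : Fin (N + 1) → PhaseSpace N → ℝ) (W : ℝ → Fin (N + 1) → Fin (N + 1) → ℝ),
    (∀ s f₁ f₂, lap s f₁ f₂ = ∫ t in Set.Ioi (0 : ℝ), Real.exp (-(s * t)) *
      ((∫ z, f₁ z * (∫ y, f₂ y ∂((pinnedChain ω₂ lam β γ).transitionKernel N T T t.toNNReal z))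
          ∂(pinnedChain ω₂ lam β γ).gibbsMeasure N T) -
        (∫ z, f₁ z ∂(pinnedChain ω₂ lam β γ).gibbsMeasure N T) *
          (∫ z, f₂ z ∂(pinnedChain ω₂ lam β γ).gibbsMeasure N T))) →
    (∀ x z, e x z = z.2 x ^ 2 / 2 + (pinnedChain ω₂ lam β γ).U (z.1 x) +
      ∑ j : Fin N, ((if j.val = x.val + 1 then (pinnedChain ω₂ lam β γ).V (z.1 j - z.1 x) / 2 else 0) +
        (if x.val = j.val + 1 then (pinnedChain ω₂ lam β γ).V (z.1 x - z.1 j) / 2 else 0))) →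
    (∀ s, G s = Matrix.of fun x y => lap s (e x) (e y)) →
    (∀ s f₁ f₂, schur s f₁ f₂ = lap s f₁ f₂ - ∑ x, ∑ y, lap s f₁ (e x) * (G s)⁻¹ x y * lap s (e y) f₂) →
    (∀ i z, g i z = (∑ b : Fin N, if b.val + 1 = i.val then (pinnedChain ω₂ lam β γ).bondCurrent N b z else 0) +
      (∑ x : Fin N, if (i.val = 0 ∧ x.val = 0) ∨ (i.val = N ∧ x.val + 1 = N) then
        (pinnedChain ω₂ lam β γ).γ * (T - z.2 x ^ 2) else 0)) →
    (∀ s i j, W s i j = (if i = j ∧ (i.val = 0 ∨ i.val = N) then (pinnedChain ω₂ lam β γ).γ * T ^ 2 else 0) -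
      schur s (fun z => g i (z.1, -z.2)) (g j)) →
    ∀ s : ℝ, 0 < s → s < s₀ → ∀ (i : Fin (N + 1)) (d : ℕ),
      ∑ j : Fin (N + 1), (if (d : ℝ) < |(i.val : ℝ) - j.val| then |W s i j| else 0) ≤ τ d := by
  sorry

/-- STUB (registered, OPEN; rank-2 class = `OrthogonalOhm`'s foreseen BulkLimit, matrix-valued) — BULK TOEPLITZ LIMIT of the
bond-current memory: there is a summable `K_∞ : ℤ → ℝ` such that for every `ε > 0` there is `R` with: for all `N ≥ 2` and
small `s > 0`, `|W_N(s)_{ij} − K_∞(i − j)| ≤ ε` for all bond positions `i, j` at distance `≥ R` from both ends (positions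
`R+1 ≤ i ≤ N−1−R`, i.e. bonds `b = i−1` with `R ≤ b`, `b+2+R ≤ N` — the quantifier shape of the typed `OrthogonalOhm`, whose
`k` is `Σ_z K_∞(z)`) AND at mutual distance `|i − j| ≤ Z`, for every fixed `Z` (`R = R(ε, Z)`; rev 2, lead c2, after
the w-bulklimit audit: the composition only compares entries inside a window of width `2L`, so convergence at FIXED distance
is all it needs — this keeps (L) = emergence of translation invariance disjoint from (U′) = decay; the rev-1 form "all bulk
pairs" silently contained uniform entrywise decay). Informal content: translation invariance emerges in the bulk of the zero-frequency orthogonal current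
memory. Why plausible: exact in the velocity-flip chain (mid-rows identical from `N = 16` on); MD `Γ` N-flat 16…128. Why it
might fail: entries drifting with `N` (two-diffuson residues `∼ N⁻²` rates surviving the projection) or no `s ↓ 0` limit.
`K_∞` is unique when it exists; it is even and `Σ_zK_∞(z)cos(zθ) ≥ 0` automatically (`schur_self_nonneg` + Bochner). -/
theorem stub_bulkLimit : ∀ ω₂ lam β γ : ℝ, 0 < ω₂ → 0 < lam → 0 < β → 0 < γ → ∀ T : ℝ, 0 < T →
    ∃ K : ℤ → ℝ, Summable K ∧ ∀ ε : ℝ, 0 < ε → ∀ Z : ℕ, ∃ R : ℕ, ∀ N : ℕ, 2 ≤ N → ∃ s₀ : ℝ, 0 < s₀ ∧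
    ∀ (lap : ℝ → (PhaseSpace N → ℝ) → (PhaseSpace N → ℝ) → ℝ) (e : Fin N → PhaseSpace N → ℝ)
      (G : ℝ → Matrix (Fin N) (Fin N) ℝ) (schur : ℝ → (PhaseSpace N → ℝ) → (PhaseSpace N → ℝ) → ℝ)
      (g : Fin (N + 1) → PhaseSpace N → ℝ) (W : ℝ → Fin (N + 1) → Fin (N + 1) → ℝ),
    (∀ s f₁ f₂, lap s f₁ f₂ = ∫ t in Set.Ioi (0 : ℝ), Real.exp (-(s * t)) *
      ((∫ z, f₁ z * (∫ y, f₂ y ∂((pinnedChain ω₂ lam β γ).transitionKernel N T T t.toNNReal z))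
          ∂(pinnedChain ω₂ lam β γ).gibbsMeasure N T) -
        (∫ z, f₁ z ∂(pinnedChain ω₂ lam β γ).gibbsMeasure N T) *
          (∫ z, f₂ z ∂(pinnedChain ω₂ lam β γ).gibbsMeasure N T))) →
    (∀ x z, e x z = z.2 x ^ 2 / 2 + (pinnedChain ω₂ lam β γ).U (z.1 x) +
      ∑ j : Fin N, ((if j.val = x.val + 1 then (pinnedChain ω₂ lam β γ).V (z.1 j - z.1 x) / 2 else 0) +
        (if x.val = j.val + 1 then (pinnedChain ω₂ lam β γ).V (z.1 x - z.1 j) / 2 else 0))) →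
    (∀ s, G s = Matrix.of fun x y => lap s (e x) (e y)) →
    (∀ s f₁ f₂, schur s f₁ f₂ = lap s f₁ f₂ - ∑ x, ∑ y, lap s f₁ (e x) * (G s)⁻¹ x y * lap s (e y) f₂) →
    (∀ i z, g i z = (∑ b : Fin N, if b.val + 1 = i.val then (pinnedChain ω₂ lam β γ).bondCurrent N b z else 0) +
      (∑ x : Fin N, if (i.val = 0 ∧ x.val = 0) ∨ (i.val = N ∧ x.val + 1 = N) then
        (pinnedChain ω₂ lam β γ).γ * (T - z.2 x ^ 2) else 0)) →
    (∀ s i j, W s i j = (if i = j ∧ (i.val = 0 ∨ i.val = N) then (pinnedChain ω₂ lam β γ).γ * T ^ 2 else 0) -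
      schur s (fun z => g i (z.1, -z.2)) (g j)) →
    ∀ s : ℝ, 0 < s → s < s₀ → ∀ i j : Fin (N + 1),
      R + 1 ≤ i.val → i.val + 1 + R ≤ N → R + 1 ≤ j.val → j.val + 1 + R ≤ N →
      i.val ≤ j.val + Z → j.val ≤ i.val + Z → |W s i j - K ((i.val : ℤ) - j.val)| ≤ ε := by
  sorry

/-! ### Open stubs — this crux's own residue (Q1), (Q2): qualitative, no rate -/

/-- STUB (registered, OPEN; the crux-specific residue Q1) — POSITIVITY OF THE BULK SYMBOL: every bulk limit `K_∞` of the
bond-current memory (in the sense of `stub_bulkLimit`; unique if it exists, the statement is about THE limit) has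
`K̂_∞(θ) = Σ'_z K_∞(z)cos(zθ) > 0` at EVERY `θ` — pointwise, no uniformity (compactness of the circle supplies it, in
`stub_toeplitzSymbol`). Meaning: `K̂_∞ ≥ 0` is automatic (Bochner, `schur_self_nonneg` p103180), so the content is the absence
of an exactly NON-RELAXING finite-wavelength energy pattern of the infinite chain (Zwanzig's memory-function identity
`K̂_∞(θ,0⁺) = χ̂(θ)²/((2−2cos θ)S̃_∞(θ,0⁺))`: positivity at `θ ≠ 0` ⟺ finite Abel-integrated autocorrelation of the energy
mode `ê_θ`); at `θ = 0` it is `Σ_zK_∞(z) = k > 0`, the route's rank-3 `PositiveMemory` end (a prover may import it once the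
fixed-`N` limits FixedNLap are available). Why it might fail: a lattice-scale (`θ ≈ π`) non-relaxing staggered energy pattern
— thermal breathers (`StrongPinningBreathers` scope; the card's falsifier (ii) looks exactly there; in the flip chain the
minimum sits at `θ = π`: `0.0565 < K̂(0) = 0.0955`). Barrier `MacroErgodicityHypothesis` bites: no printed tool proves even
this per-wavelength relaxation for a deterministic anharmonic chain; the line claims the REDUCTION. -/
theorem stub_symbolPositivity : ∀ ω₂ lam β γ : ℝ, 0 < ω₂ → 0 < lam → 0 < β → 0 < γ → ∀ T : ℝ, 0 < T →
    ∀ K : ℤ → ℝ, Summable K →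
    (∀ ε : ℝ, 0 < ε → ∀ Z : ℕ, ∃ R : ℕ, ∀ N : ℕ, 2 ≤ N → ∃ s₀ : ℝ, 0 < s₀ ∧
    ∀ (lap : ℝ → (PhaseSpace N → ℝ) → (PhaseSpace N → ℝ) → ℝ) (e : Fin N → PhaseSpace N → ℝ)
      (G : ℝ → Matrix (Fin N) (Fin N) ℝ) (schur : ℝ → (PhaseSpace N → ℝ) → (PhaseSpace N → ℝ) → ℝ)
      (g : Fin (N + 1) → PhaseSpace N → ℝ) (W : ℝ → Fin (N + 1) → Fin (N + 1) → ℝ),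
    (∀ s f₁ f₂, lap s f₁ f₂ = ∫ t in Set.Ioi (0 : ℝ), Real.exp (-(s * t)) *
      ((∫ z, f₁ z * (∫ y, f₂ y ∂((pinnedChain ω₂ lam β γ).transitionKernel N T T t.toNNReal z))
          ∂(pinnedChain ω₂ lam β γ).gibbsMeasure N T) -
        (∫ z, f₁ z ∂(pinnedChain ω₂ lam β γ).gibbsMeasure N T) *
          (∫ z, f₂ z ∂(pinnedChain ω₂ lam β γ).gibbsMeasure N T))) →
    (∀ x z, e x z = z.2 x ^ 2 / 2 + (pinnedChain ω₂ lam β γ).U (z.1 x) +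
      ∑ j : Fin N, ((if j.val = x.val + 1 then (pinnedChain ω₂ lam β γ).V (z.1 j - z.1 x) / 2 else 0) +
        (if x.val = j.val + 1 then (pinnedChain ω₂ lam β γ).V (z.1 x - z.1 j) / 2 else 0))) →
    (∀ s, G s = Matrix.of fun x y => lap s (e x) (e y)) →
    (∀ s f₁ f₂, schur s f₁ f₂ = lap s f₁ f₂ - ∑ x, ∑ y, lap s f₁ (e x) * (G s)⁻¹ x y * lap s (e y) f₂) →
    (∀ i z, g i z = (∑ b : Fin N, if b.val + 1 = i.val then (pinnedChain ω₂ lam β γ).bondCurrent N b z else 0) +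
      (∑ x : Fin N, if (i.val = 0 ∧ x.val = 0) ∨ (i.val = N ∧ x.val + 1 = N) then
        (pinnedChain ω₂ lam β γ).γ * (T - z.2 x ^ 2) else 0)) →
    (∀ s i j, W s i j = (if i = j ∧ (i.val = 0 ∨ i.val = N) then (pinnedChain ω₂ lam β γ).γ * T ^ 2 else 0) -
      schur s (fun z => g i (z.1, -z.2)) (g j)) →
    ∀ s : ℝ, 0 < s → s < s₀ → ∀ i j : Fin (N + 1),
      R + 1 ≤ i.val → i.val + 1 + R ≤ N → R + 1 ≤ j.val → j.val + 1 + R ≤ N →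
      i.val ≤ j.val + Z → j.val ≤ i.val + Z → |W s i j - K ((i.val : ℤ) - j.val)| ≤ ε) →
    ∀ θ : ℝ, 0 < ∑' z : ℤ, K z * Real.cos (z * θ) := by
  sorry

/-- STUB (registered, OPEN; the crux-specific residue Q2 merged with the contact limit — section-coercivity of the corner
windows, as triage r2-2 asked: no HVZ step is needed in Lean) — CORNER COERCIVITY: there is `m > 0` such that for every window
size `w` there is `N₁` with: for all `N ≥ N₁` (`N ≥ 2`) and small `s > 0`, `vᵀW_N(s)v ≥ m|v|²` for every `v` supported on
the first `w` positions (left contact + `w−1` bonds) and for every `v` supported on the last `w` positions. Informal content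
(limit-operator reading): the corner compressions converge to a half-line matrix `W_half` (= Toeplitz(`K_∞`) + compact), and
`inf_w λ_min(W_half|_w) > 0` ⟺ `0` is not an eigenvalue of `W_half` — NO CONTACT-TRAPPED ℓ² ZERO MODE (HVZ: `inf σ_ess(W_half)
= min K̂_∞ > 0` by Q1). THIS IS WHERE `γ > 0` IS LOAD-BEARING: the contact diagonal entry is `γT² − γ²schur(p_c²,p_c²)`
(`= 0.904` at the reference point, `≤ γT²` = `robinConst_le_contact'` p105854) and at `γ = 0` the contact coordinate
`δ_c` is an exact zero mode of every corner section — `robinCoercivity_false_without_coupling` read on the limit object.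
Why plausible: flip chain corner bottoms `0.0578/0.0564/0.0562/0.0562` (`w = 3,5,8,≥12`), N-identical; harmonic contact
block `0.9047·I` with margin. Why it might fail: a boundary-trapped pattern `(η; a)` with zero Feshbach energy at strong
coupling (Kapitza regime, `c·γ → 0.24`), or corner entries drifting with `N`. Slightly stronger than the contact part of
the crux (coercivity on all corner vectors, not only on `Ran B`; numerically `λ_min(W_N) = c_N` on the full space). -/
theorem stub_cornerCoercivity : ∀ ω₂ lam β γ : ℝ, 0 < ω₂ → 0 < lam → 0 < β → 0 < γ → ∀ T : ℝ, 0 < T →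
    ∃ m : ℝ, 0 < m ∧ ∀ w : ℕ, ∃ N₁ : ℕ, ∀ N : ℕ, N₁ ≤ N → 2 ≤ N → ∃ s₀ : ℝ, 0 < s₀ ∧
    ∀ (lap : ℝ → (PhaseSpace N → ℝ) → (PhaseSpace N → ℝ) → ℝ) (e : Fin N → PhaseSpace N → ℝ)
      (G : ℝ → Matrix (Fin N) (Fin N) ℝ) (schur : ℝ → (PhaseSpace N → ℝ) → (PhaseSpace N → ℝ) → ℝ)
      (g : Fin (N + 1) → PhaseSpace N → ℝ) (W : ℝ → Fin (N + 1) → Fin (N + 1) → ℝ),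
    (∀ s f₁ f₂, lap s f₁ f₂ = ∫ t in Set.Ioi (0 : ℝ), Real.exp (-(s * t)) *
      ((∫ z, f₁ z * (∫ y, f₂ y ∂((pinnedChain ω₂ lam β γ).transitionKernel N T T t.toNNReal z))
          ∂(pinnedChain ω₂ lam β γ).gibbsMeasure N T) -
        (∫ z, f₁ z ∂(pinnedChain ω₂ lam β γ).gibbsMeasure N T) *
          (∫ z, f₂ z ∂(pinnedChain ω₂ lam β γ).gibbsMeasure N T))) →
    (∀ x z, e x z = z.2 x ^ 2 / 2 + (pinnedChain ω₂ lam β γ).U (z.1 x) +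
      ∑ j : Fin N, ((if j.val = x.val + 1 then (pinnedChain ω₂ lam β γ).V (z.1 j - z.1 x) / 2 else 0) +
        (if x.val = j.val + 1 then (pinnedChain ω₂ lam β γ).V (z.1 x - z.1 j) / 2 else 0))) →
    (∀ s, G s = Matrix.of fun x y => lap s (e x) (e y)) →
    (∀ s f₁ f₂, schur s f₁ f₂ = lap s f₁ f₂ - ∑ x, ∑ y, lap s f₁ (e x) * (G s)⁻¹ x y * lap s (e y) f₂) →
    (∀ i z, g i z = (∑ b : Fin N, if b.val + 1 = i.val then (pinnedChain ω₂ lam β γ).bondCurrent N b z else 0) +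
      (∑ x : Fin N, if (i.val = 0 ∧ x.val = 0) ∨ (i.val = N ∧ x.val + 1 = N) then
        (pinnedChain ω₂ lam β γ).γ * (T - z.2 x ^ 2) else 0)) →
    (∀ s i j, W s i j = (if i = j ∧ (i.val = 0 ∨ i.val = N) then (pinnedChain ω₂ lam β γ).γ * T ^ 2 else 0) -
      schur s (fun z => g i (z.1, -z.2)) (g j)) →
    ∀ s : ℝ, 0 < s → s < s₀ →
      (∀ v : Fin (N + 1) → ℝ, (∀ i : Fin (N + 1), w ≤ i.val → v i = 0) →
        m * ∑ i, v i ^ 2 ≤ ∑ i, ∑ j, v i * W s i j * v j) ∧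
      (∀ v : Fin (N + 1) → ℝ, (∀ i : Fin (N + 1), i.val + w < N + 1 → v i = 0) →
        m * ∑ i, v i ^ 2 ≤ ∑ i, ∑ j, v i * W s i j * v j) := by
  sorry

/-! ## The composition (sorry-free): one line through the landed transfer theorem -/

/-- **`RobinCoercivity`** (crux stmt-AtomisticToContinuum-12695 of route `HonestZwanzig`) from the four open stubs, through the
landed transfer theorem `Robin.robinCoercivity_of_limitOperatorInputs` (IMS localisation + Toeplitz symbol bound + block form +
pointwise small-`N`, all in `Theorems/`). -/
theorem RobinCoercivity_of : RobinCoercivity :=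
  Robin.robinCoercivity_of_limitOperatorInputs stub_bandDomination stub_bulkLimit stub_symbolPositivity stub_cornerCoercivity

/-! ## Scratch checks against the disprover's landed `Negative/` lemmas (documentation only)

* `γ > 0` is load-bearing (`robinCoercivity_false_without_coupling`): the line uses it at `stub_cornerCoercivity` — the
  contact diagonal entry of `W_N(s)` is `γT² − γ²schur_s(T−p_c², T−p_c²)`, and at `γ = 0` the contact coordinate is an
  exact zero mode of every corner section, so `m > 0` there is impossible; no other stub mentions the contacts' sign.
* `robinConst_le_contact'` (`c ≤ γT²`): the composition's constant is `≤ m₂/2 ≤ W_{00}/2 ≤ γT²/2` — consistent.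
* `not_uniformL2Ellipticity'`: the line claims coercivity of `W_N` on bond ⊕ contact space (`= |Bξ|²`, the Robin
  normalisation), never `ℓ²`-ellipticity of `𝔽_N` on sites.
* `not_robinCoercivityUniformInT'` / `not_robinCoercivityUniformInCoupling'`: `τ, K_∞, m₁, m₂` (hence `c`) depend on
  `T` and `γ`; nothing uniform in them is claimed.
* Negatives index (`ledger negatives --problem AtomisticToContinuum`, FouriersLaw: `not_OddCorrectorDecay`,
  `DiluteCellGaussianiser…`): no stub has the shape of a refuted statement (U′ is zero-frequency spatial decay of the
  ORTHOGONAL memory, not an `L¹`-in-time bound on an odd corrector of the full dynamics). -/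

/-- The structure theorems of rev 5 (documentation): the shared inputs and the residues close every open crux of the route. -/
example : Robin.BlockBandDomination → Robin.BlockBulkLimit → Robin.BlockDiagBound → Robin.BulkSymbolPositivity →
    Robin.CornerCoercivity → OrthogonalOhm ∧ PositiveMemory ∧ RobinCoercivity := fun hU hL hD h1 h2 =>
  ⟨(Robin.cruxes_of_blockInputs hU hL hD h1 h2).2, Robin.positiveMemory_of_blockInputs hU hL h1,
    (Robin.cruxes_of_blockInputs hU hL hD h1 h2).1⟩
example : Robin.BlockBandDomination → Robin.BlockBulkLimit → Robin.BlockDiagBound →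
    (RobinCoercivity ↔ (Robin.BulkSymbolPositivity ∧ Robin.CornerCoercivity)) := Robin.robinCoercivity_iff_residues'

example : ¬ Negative.RobinCoercivityNonnegCoupling := Negative.robinCoercivity_false_without_coupling
example : ¬ Negative.UniformL2Ellipticity := Negative.not_uniformL2Ellipticity'
example : ¬ Negative.RobinCoercivityUniformInT := Negative.not_robinCoercivityUniformInT'
example : ¬ Negative.RobinCoercivityUniformInCoupling := Negative.not_robinCoercivityUniformInCoupling'

end Summit.AtomisticToContinuum.FouriersLaw.Cruxes.RobinCoercivity.LimitOperatorMemoryForm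

end
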